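import Summits.ResolutionOfSingularities.ResolutionOfSingularities.Theorems.FrobeniusClosingSteerSwitchRecurrence

/-!
# Crux `Steer` (stmt-ResolutionOfSingularities-16345), chain W4.1, (Par-S) hARᵒ slot (H2), the A6 DICTIONARY: «the parameter `x` FAILS to be
# exceptional at a point step» ⟺ «the new centre lies on the strict transform of `V(x)`» (a SATELLITE step)
# (res-type-062 g15; res-L0-w41-tri-1 PREREG-FB v1.6.2 A6; Theses-free support)

OURS (campaign `res-hironaka`, rung L ★L-G4, slot W4.1; statements about the route's own objects — one local blowing up `B ↦ B'` along an ideal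
`I` of `B` with respect to `O`, an exceptional parameter `u` of it, and an element `x ∈ I`; they replace the role of no printed item and are NOT
statements of the manuscript under review [claim: Hironaka2017, status: under-review]; AI review is weaker than expert review). Seat res-type-062 g15.
Definition-free; no Theses file is imported.

## What is proved

For a local blowing up `hbl : IsLocalBlowupAlong O B I B'` with exceptional parameter `u` (element of `I`, non-zero, of maximal `O`-value on `I`)
and `x ∈ I`, `x ≠ 0`:
* `div_excParam_mem` — `x / u ∈ B'`;
* `valuation_lt_iff_not_max` — `x` is NOT of maximal value on `I` iff `v x < v u`;
* **`not_excParam_iff_div_mem_nonunits`** — `x` fails the exceptional-parameter clause iff `x / u` is a NON-UNIT of `B'` (value `< 1`), i.e. the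
  centre of `O` on `B'` lies on the strict transform `{x/u = 0}` of `V(x)`: tri-1's A6 «a late parameter switch = a satellite step», in the
  algebraic currency the (H2) analysis ((R2)/(R4)) consumes after `SwitchVisit.exists_consecutive_switch`.

[cite: NovacoskiSpivakovsky2014, Def. 2.11] [folklore]
-/

-- `Summit.<S>.<S>.…` duplicates the summit name by design (single-problem summit).
set_option linter.dupNamespace false

open IsLocalRing
open Literature.AlgebraicGeometry.Resolution (IsLocalBlowupAlong SubringDominates)

namespace Summit.ResolutionOfSingularities.ResolutionOfSingularities.Theorems.SwitchingDichotomy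

namespace SatelliteStep

variable {K : Type} [Field K] {O : ValuationSubring K} {B B' : Subring K} {I : Ideal B}

/-- `x / u ∈ B'` for `x ∈ I` and `u` an exceptional parameter of the blowing up along `I` (= `OddBranchPersistence.div_mem_of_isLocalBlowupAlong`,
restated for an element given with its membership proof). [folklore] -/
theorem div_excParam_mem (hbl : IsLocalBlowupAlong O B I B') {u x : K}
    (hu : (∃ h : u ∈ B, (⟨u, h⟩ : B) ∈ I) ∧ u ≠ 0 ∧ ∀ y : B, y ∈ I → O.valuation (y : K) ≤ O.valuation u)
    (hxB : x ∈ B) (hxI : (⟨x, hxB⟩ : B) ∈ I) : x / u ∈ B' :=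
  OddBranchPersistence.div_mem_of_isLocalBlowupAlong hbl hu.1 hu.2.1 hu.2.2 ⟨x, hxB⟩ hxI

/-- For `u` an exceptional parameter along `I`: an element `x` is NOT of maximal value on `I` iff `v x < v u`. [folklore] -/
theorem valuation_lt_iff_not_max {u x : K}
    (hu : (∃ h : u ∈ B, (⟨u, h⟩ : B) ∈ I) ∧ u ≠ 0 ∧ ∀ y : B, y ∈ I → O.valuation (y : K) ≤ O.valuation u) :
    O.valuation x < O.valuation u ↔ ¬ ∀ y : B, y ∈ I → O.valuation (y : K) ≤ O.valuation x := by
  obtain ⟨⟨huB, huI⟩, -, humax⟩ := hu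
  constructor
  · intro hlt hmax
    exact absurd (hmax ⟨u, huB⟩ huI) (not_le.mpr hlt)
  · intro hnot
    by_contra hge
    apply hnot
    intro y hy
    exact (humax y hy).trans (not_lt.mp hge)

/-- **A6 dictionary, value form.** With `u` an exceptional parameter along `I`: `x` FAILS the exceptional-parameter clause iff the strict
transform `x / u` of `V(x)` has `O`-value `< 1` (the centre of `O` on the blown-up member lies on it: a SATELLITE step). [folklore] -/
theorem not_excParam_iff_valuation_div_lt_one {u x : K}
    (hu : (∃ h : u ∈ B, (⟨u, h⟩ : B) ∈ I) ∧ u ≠ 0 ∧ ∀ y : B, y ∈ I → O.valuation (y : K) ≤ O.valuation u) :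
    (¬ ∀ y : B, y ∈ I → O.valuation (y : K) ≤ O.valuation x) ↔ O.valuation (x / u) < 1 := by
  have hu0 : u ≠ 0 := hu.2.1
  have hvu0 : O.valuation u ≠ 0 := (map_ne_zero _).mpr hu0
  rw [← valuation_lt_iff_not_max hu, map_div₀, div_lt_one₀ (pos_iff_ne_zero.mpr hvu0)]

/-- The same, phrased with units of the new member: `x` fails to be exceptional iff `x / u` is NOT a unit of `B'`. [folklore] -/
theorem not_excParam_iff_div_not_isUnit (hdom' : SubringDominates B' O.toSubring) (hbl : IsLocalBlowupAlong O B I B') {u x : K}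
    (hu : (∃ h : u ∈ B, (⟨u, h⟩ : B) ∈ I) ∧ u ≠ 0 ∧ ∀ y : B, y ∈ I → O.valuation (y : K) ≤ O.valuation u)
    (hxB : x ∈ B) (hxI : (⟨x, hxB⟩ : B) ∈ I) (hx0 : x ≠ 0) :
    (¬ ∀ y : B, y ∈ I → O.valuation (y : K) ≤ O.valuation x) ↔
      ¬ IsUnit (⟨x / u, div_excParam_mem hbl hu hxB hxI⟩ : B') := by
  rw [not_excParam_iff_valuation_div_lt_one hu]
  constructor
  · intro hlt hunit
    -- a unit of a member dominated by `O` has value `1`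
    have hinv : (x / u)⁻¹ ∈ B' := ((Literature.AlgebraicGeometry.Resolution.isUnit_subring_iff_inv_mem _).mp hunit).2
    have h1 : O.valuation (x / u)⁻¹ ≤ 1 := (O.valuation_le_one_iff _).mpr (hdom'.1 hinv)
    have hxu0 : x / u ≠ 0 := div_ne_zero hx0 hu.2.1
    rw [map_inv₀, inv_le_one₀ (pos_iff_ne_zero.mpr ((map_ne_zero _).mpr hxu0))] at h1
    exact absurd hlt (not_lt.mpr h1)
  · intro hnu
    exact SwitchRecurrence.valuation_lt_one_of_not_isUnit hdom' _ hnu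

end SatelliteStep

end Summit.ResolutionOfSingularities.ResolutionOfSingularities.Theorems.SwitchingDichotomy
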